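import Mathlib
import Summits.NavierStokesRegularity.NavierStokesRegularity.Theorems.EulerZoomLiouvillePowerGaugeEulerLiouvilleSelfSimilarEndpointIteration
import HarnessLib

/-!
# Rung C1 of the crux `EulerZoomLiouville.PowerGaugeEulerLiouville` at the endpoint `ρ = 1/2`:
# the shell-energy iteration with a SUBLINEAR POWER of the window sum (real-variable part of the
# growth-free energy drain)

Route №10 `EulerZoomLiouville` (NavierStokesRegularity), crux E = stmt-NavierStokesRegularity-19832,
registered open stub `stub_selfSimilarWeakRest`, endpoint `ρ = 1/2`.  The tree's iteration
(`shell_recursion_step` / `shell_decay_of_recursion`, `…SelfSimilarEndpointIteration`) is Chae–Shvydkoy's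
(ARMA 209 (2013), proof of Thm 3.1): the recursion `f(L) ≤ C₁ L^{-δ} S(L) + C₂ √(S(L)) L^{-κ}` for the
dyadic shell energies `f(L) = ∫_{L≤|y|<2L} |V|²` is LINEAR in the window sum `S(L)`, which is where the
POINTWISE sublinear growth `|V(y)| ≤ C|y|^{1-δ}` of the profile enters (it bounds the cubic flux and the
near Riesz pressure by `sup |V| × energy`).  In Seregin's class the profile carries a weak gradient with
`∫ |∇V|² |y|^{-1/2} < ∞`; the local Sobolev inequality then bounds the same two terms by
`L^{3/8} S(L)^{3/4}` WITHOUT any pointwise hypothesis (sequel `…SelfSimilarEndpointSobolevShell`), and the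
recursion takes the form

`f(L) ≤ C₁ L^{-θ} S(L)^q + C₂ √(S(L)) L^{-κ}`, `0 ≤ q < 1`

(`θ = 5/8`, `q = 3/4`, `κ = 5/2`).  This file runs that iteration:

* `EndpointSobolev.shell_recursion_step_rpow` — one bootstrap step: `f(L) ≤ D L^{-a}` (`L ≥ 1`)
  improves to `f(L) ≤ D' L^{-b}` for every `0 ≤ b ≤ min(θ + q a, a/2 + κ)`;
* `EndpointSobolev.shell_decay_of_recursion_rpow` — hence `f(L) ≤ C_ε L^{-a⋆+ε}` for every `ε > 0`,
  `a⋆ = min(θ/(1-q), 2κ)` the least fixed point of the increasing concave exponent map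
  `a ↦ min(θ + q a, a/2 + κ)` (the iterates `a_n = a⋆(1 - λⁿ)`, `λ = max(q, 1/2)`, are admissible);
  with `(θ, q, κ) = (5/8, 3/4, 5/2)`: `a⋆ = 5/2` — every endpoint profile of the class drains at
  the rate `L^{-5/2+ε}`;
* `EndpointSobolev.false_of_shell_recursion_rpow_of_lower_bound` — a lower bound
  `f(L) ≥ c L^{-a⋆+η}` (`η > 0`) along radii `L` BEYOND EVERY BOUND is contradictory.

Pure real analysis (no measure theory); the PDE input is in the sequel files.

WHAT THIS IS NOT: not NS, not E, not the stub — bookkeeping for the growth-free endpoint drain.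
-/

noncomputable section

-- flat `Theorems/<Route><Decl>…` files of one crux share the namespace of the crux (tree convention)
set_option linter.dupNamespace false

open Finset Filter

namespace Summit.NavierStokesRegularity.NavierStokesRegularity.Theorems.PowerGaugeEulerLiouville

namespace EndpointSobolev

section Iteration

variable {f S : ℝ → ℝ} {B C₁ C₂ θ q κ L₁ : ℝ} {m : ℕ}

/-- **One bootstrap step of the shell recursion with a power of the window sum.**  Let `f ≥ 0` be
bounded by `B` on `(0, ∞)` and satisfy, for `L ≥ L₁`, `f(L) ≤ C₁ L^{-θ} S(L)^q + C₂ √(S(L)) L^{-κ}`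
(`q ≥ 0`) with the dyadic window sum `S(L) = Σ_{k=0}^{2m} f(2^k L/2^m)`.  If `f(L) ≤ D L^{-a}` for all
`L ≥ 1` (`a ≥ 0`), then `f(L) ≤ D' L^{-b}` for all `L ≥ 1`, for every `0 ≤ b` with `b ≤ θ + q a` and
`b ≤ a/2 + κ`. [folklore; cf. ChaeShvydkoy2013 §3.1 proof of Thm. 3.1 (iteration of (3.3))] -/
theorem shell_recursion_step_rpow (hf0 : ∀ L, 0 < L → 0 ≤ f L) (hfB : ∀ L, 0 < L → f L ≤ B)
    (hC₁ : 0 ≤ C₁) (hC₂ : 0 ≤ C₂) (hL₁ : 0 < L₁) (hq0 : 0 ≤ q)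
    (hS : ∀ L, S L = ∑ k ∈ range (2 * m + 1), f (2 ^ k * L / 2 ^ m))
    (hrec : ∀ L, L₁ ≤ L → f L ≤ C₁ * L ^ (-θ) * S L ^ q + C₂ * Real.sqrt (S L) * L ^ (-κ))
    {D a b : ℝ} (ha : 0 ≤ a) (hD : ∀ L, 1 ≤ L → f L ≤ D * L ^ (-a))
    (hb0 : 0 ≤ b) (hb1 : b ≤ θ + q * a) (hb2 : b ≤ a / 2 + κ) :
    ∃ D' : ℝ, ∀ L, 1 ≤ L → f L ≤ D' * L ^ (-b) := by
  have h2m : (0 : ℝ) < 2 ^ m := by positivity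
  set L₂ : ℝ := max L₁ (2 ^ m) with hL₂
  have hL₂0 : 0 < L₂ := lt_max_of_lt_left hL₁
  have hB0 : 0 ≤ B := (hf0 1 one_pos).trans (hfB 1 one_pos)
  have hD0 : 0 ≤ D := by
    have h1 := hD 1 le_rfl
    rw [Real.one_rpow, mul_one] at h1
    exact (hf0 1 one_pos).trans h1
  set E : ℝ := (2 * m + 1) * (D * ((2 : ℝ) ^ m) ^ a) with hE
  have hE0 : 0 ≤ E := by positivity
  refine ⟨max (B * L₂ ^ b) (C₁ * E ^ q + C₂ * Real.sqrt E), fun L hL => ?_⟩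
  have hL0 : 0 < L := one_pos.trans_le hL
  have hLb : 0 < L ^ (-b) := Real.rpow_pos_of_pos hL0 _
  rcases lt_or_ge L L₂ with hlt | hge
  · -- small scales: the crude bound
    have h1 : f L ≤ B := hfB L hL0
    have h2 : (1 : ℝ) ≤ L₂ ^ b * L ^ (-b) := by
      rw [Real.rpow_neg hL0.le, ← div_eq_mul_inv, ← Real.div_rpow hL₂0.le hL0.le]
      exact Real.one_le_rpow ((one_le_div hL0).2 hlt.le) hb0
    calc f L ≤ B * (L₂ ^ b * L ^ (-b)) := by nlinarith
      _ = (B * L₂ ^ b) * L ^ (-b) := by ring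
      _ ≤ max (B * L₂ ^ b) (C₁ * E ^ q + C₂ * Real.sqrt E) * L ^ (-b) :=
          mul_le_mul_of_nonneg_right (le_max_left _ _) hLb.le
  · -- large scales: the recursion
    have hL₁L : L₁ ≤ L := (le_max_left _ _).trans hge
    have hmL : (2 : ℝ) ^ m ≤ L := (le_max_right _ _).trans hge
    have hSle : S L ≤ E * L ^ (-a) := by
      have := windowSum_le_of_pow_bound hf0 hS ha hD hmL
      rw [hE]; linarith
    have hS0 : 0 ≤ S L := windowSum_nonneg hf0 hS hL0
    have hLa : 0 < L ^ (-a) := Real.rpow_pos_of_pos hL0 _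
    -- the power of the window sum
    have hSq : S L ^ q ≤ E ^ q * L ^ (-(q * a)) := by
      calc S L ^ q ≤ (E * L ^ (-a)) ^ q := Real.rpow_le_rpow hS0 hSle hq0
        _ = E ^ q * (L ^ (-a)) ^ q := Real.mul_rpow hE0 hLa.le
        _ = E ^ q * L ^ (-(q * a)) := by
            rw [← Real.rpow_mul hL0.le]; ring_nf
    -- the two exponent comparisons (`L ≥ 1`)
    have hpow1 : L ^ (-θ) * L ^ (-(q * a)) ≤ L ^ (-b) := by
      rw [← Real.rpow_add hL0]
      exact Real.rpow_le_rpow_of_exponent_le hL (by linarith)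
    have hpow2 : Real.sqrt (L ^ (-a)) * L ^ (-κ) ≤ L ^ (-b) := by
      rw [Real.sqrt_eq_rpow, ← Real.rpow_mul hL0.le, ← Real.rpow_add hL0]
      exact Real.rpow_le_rpow_of_exponent_le hL (by linarith)
    have hsqrt : Real.sqrt (S L) ≤ Real.sqrt E * Real.sqrt (L ^ (-a)) := by
      rw [← Real.sqrt_mul hE0]
      exact Real.sqrt_le_sqrt hSle
    have hLθ : 0 ≤ L ^ (-θ) := (Real.rpow_pos_of_pos hL0 _).le
    have hEq : 0 ≤ E ^ q := Real.rpow_nonneg hE0 _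
    calc f L ≤ C₁ * L ^ (-θ) * S L ^ q + C₂ * Real.sqrt (S L) * L ^ (-κ) := hrec L hL₁L
      _ ≤ C₁ * L ^ (-θ) * (E ^ q * L ^ (-(q * a))) +
            C₂ * (Real.sqrt E * Real.sqrt (L ^ (-a))) * L ^ (-κ) := by
          gcongr
      _ = C₁ * E ^ q * (L ^ (-θ) * L ^ (-(q * a))) +
            C₂ * Real.sqrt E * (Real.sqrt (L ^ (-a)) * L ^ (-κ)) := by ring
      _ ≤ C₁ * E ^ q * L ^ (-b) + C₂ * Real.sqrt E * L ^ (-b) := by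
          gcongr
      _ = (C₁ * E ^ q + C₂ * Real.sqrt E) * L ^ (-b) := by ring
      _ ≤ max (B * L₂ ^ b) (C₁ * E ^ q + C₂ * Real.sqrt E) * L ^ (-b) :=
          mul_le_mul_of_nonneg_right (le_max_right _ _) hLb.le

/-- **Geometric iteration to the least fixed point `a⋆ = min(θ/(1-q), 2κ)`.**  Under the hypotheses of
`shell_recursion_step_rpow` (nonnegative bounded `f`, the shell recursion with `θ > 0`, `0 ≤ q < 1`,
`κ > 0`), for every `ε > 0` there is `C` with `f(L) ≤ C L^{-a⋆+ε}` for all `L ≥ 1`.  The admissible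
exponents `a_n = a⋆ (1 - λⁿ)`, `λ = max(q, 1/2) < 1`, increase to `a⋆`: `a_{n+1} ≤ θ + q a_n` because
`θ ≥ (1-q) a⋆`, and `a_{n+1} ≤ κ + a_n/2` because `κ ≥ a⋆/2`.  With `(θ, q, κ) = (5/8, 3/4, 5/2)`
(cubic flux and near pressure by the local Sobolev inequality, far pressure of an `L²` field) this is
the growth-free drain rate `L^{-5/2+ε}` of the endpoint profiles of Seregin's class. [folklore] -/
theorem shell_decay_of_recursion_rpow (hf0 : ∀ L, 0 < L → 0 ≤ f L) (hfB : ∀ L, 0 < L → f L ≤ B)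
    (hθ : 0 < θ) (hq0 : 0 ≤ q) (hq1 : q < 1) (hκ : 0 < κ) (hC₁ : 0 ≤ C₁) (hC₂ : 0 ≤ C₂)
    (hL₁ : 0 < L₁) (hS : ∀ L, S L = ∑ k ∈ range (2 * m + 1), f (2 ^ k * L / 2 ^ m))
    (hrec : ∀ L, L₁ ≤ L → f L ≤ C₁ * L ^ (-θ) * S L ^ q + C₂ * Real.sqrt (S L) * L ^ (-κ))
    {ε : ℝ} (hε : 0 < ε) :
    ∃ C : ℝ, ∀ L, 1 ≤ L → f L ≤ C * L ^ (-(min (θ / (1 - q)) (2 * κ)) + ε) := by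
  have hB0 : 0 ≤ B := (hf0 1 one_pos).trans (hfB 1 one_pos)
  set A : ℝ := min (θ / (1 - q)) (2 * κ) with hA
  have h1q : 0 < 1 - q := by linarith
  have hA0 : 0 ≤ A := le_min (div_nonneg hθ.le h1q.le) (by linarith)
  have hAθ : (1 - q) * A ≤ θ := by
    have : A ≤ θ / (1 - q) := min_le_left _ _
    rwa [le_div_iff₀ h1q, mul_comm] at this
  have hAκ : A ≤ 2 * κ := min_le_right _ _
  set lam : ℝ := max q (1 / 2) with hlam
  have hlam0 : 0 ≤ lam := hq0.trans (le_max_left _ _)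
  have hlam1 : lam < 1 := max_lt hq1 (by norm_num)
  have hqlam : q ≤ lam := le_max_left _ _
  have hhalf : (1 / 2 : ℝ) ≤ lam := le_max_right _ _
  -- the admissible exponents `a_n = A (1 - λⁿ)`
  have hiter : ∀ n : ℕ, ∃ D : ℝ, ∀ L, 1 ≤ L → f L ≤ D * L ^ (-(A * (1 - lam ^ n))) := by
    intro n
    induction n with
    | zero =>
      refine ⟨B, fun L hL => ?_⟩
      rw [pow_zero, sub_self, mul_zero, neg_zero, Real.rpow_zero, mul_one]
      exact hfB L (one_pos.trans_le hL)
    | succ n ih =>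
      obtain ⟨D, hD⟩ := ih
      have hln : 0 ≤ lam ^ n := pow_nonneg hlam0 n
      have hln1 : lam ^ n ≤ 1 := pow_le_one₀ hlam0 hlam1.le
      have ha : 0 ≤ A * (1 - lam ^ n) := mul_nonneg hA0 (by linarith)
      refine shell_recursion_step_rpow hf0 hfB hC₁ hC₂ hL₁ hq0 hS hrec ha hD
        (mul_nonneg hA0 (by linarith [pow_le_one₀ hlam0 hlam1.le (n := n + 1)])) ?_ ?_
      · -- `A(1 - λ^{n+1}) ≤ θ + q A (1 - λⁿ)` since `θ ≥ (1-q)A` and `q ≤ λ`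
        have h1 : q * (A * lam ^ n) ≤ lam * (A * lam ^ n) :=
          mul_le_mul_of_nonneg_right hqlam (mul_nonneg hA0 hln)
        rw [pow_succ]
        nlinarith
      · -- `A(1 - λ^{n+1}) ≤ A(1 - λⁿ)/2 + κ` since `κ ≥ A/2` and `1/2 ≤ λ`
        have h1 : (1 / 2) * (A * lam ^ n) ≤ lam * (A * lam ^ n) :=
          mul_le_mul_of_nonneg_right hhalf (mul_nonneg hA0 hln)
        rw [pow_succ]
        nlinarith
  -- choose `n` with `A λⁿ ≤ ε`
  obtain ⟨n, hn⟩ : ∃ n : ℕ, A * lam ^ n ≤ ε := by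
    rcases eq_or_lt_of_le hA0 with h0 | hpos
    · exact ⟨0, by rw [← h0, zero_mul]; exact hε.le⟩
    · obtain ⟨n, hn⟩ := exists_pow_lt_of_lt_one (div_pos hε hpos) hlam1
      refine ⟨n, ?_⟩
      rw [lt_div_iff₀ hpos] at hn
      linarith [mul_comm (lam ^ n) A]
  obtain ⟨D, hD⟩ := hiter n
  have hD0 : 0 ≤ D := by
    have h1 := hD 1 le_rfl
    rw [Real.one_rpow, mul_one] at h1
    exact (hf0 1 one_pos).trans h1
  refine ⟨D, fun L hL => (hD L hL).trans (mul_le_mul_of_nonneg_left ?_ hD0)⟩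
  exact Real.rpow_le_rpow_of_exponent_le hL (by rw [hA]; linarith)

/-- **Endgame: a lower power bound above the drain rate, along radii beyond every bound, is
contradictory.**  If, in addition to the hypotheses of `shell_decay_of_recursion_rpow`,
`f(L) ≥ c L^{-a⋆+η}` for some `c, η > 0` and radii `L` beyond every bound (`a⋆ = min(θ/(1-q), 2κ)`),
we reach a contradiction (`f(L) ≤ C L^{-a⋆+η/2}` while `L^{η/2} → ∞`). [folklore] -/
theorem false_of_shell_recursion_rpow_of_lower_bound (hf0 : ∀ L, 0 < L → 0 ≤ f L)
    (hfB : ∀ L, 0 < L → f L ≤ B) (hθ : 0 < θ) (hq0 : 0 ≤ q) (hq1 : q < 1) (hκ : 0 < κ)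
    (hC₁ : 0 ≤ C₁) (hC₂ : 0 ≤ C₂) (hL₁ : 0 < L₁)
    (hS : ∀ L, S L = ∑ k ∈ range (2 * m + 1), f (2 ^ k * L / 2 ^ m))
    (hrec : ∀ L, L₁ ≤ L → f L ≤ C₁ * L ^ (-θ) * S L ^ q + C₂ * Real.sqrt (S L) * L ^ (-κ))
    {c η : ℝ} (hc : 0 < c) (hη : 0 < η)
    (hlow : ∀ L₀ : ℝ, ∃ L, L₀ ≤ L ∧ c * L ^ (-(min (θ / (1 - q)) (2 * κ)) + η) ≤ f L) :
    False := by
  obtain ⟨C, hC⟩ := shell_decay_of_recursion_rpow hf0 hfB hθ hq0 hq1 hκ hC₁ hC₂ hL₁ hS hrec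
    (half_pos hη)
  set A : ℝ := min (θ / (1 - q)) (2 * κ) with hA
  -- for `L ≥ 1` in the lower-bound set: `c L^{η/2} ≤ C`
  have hkey : ∀ L, 1 ≤ L → c * L ^ (-A + η) ≤ f L → c * L ^ (η / 2) ≤ C := by
    intro L hL1 hlowL
    have hL0 : 0 < L := one_pos.trans_le hL1
    have h1 := hlowL.trans (hC L hL1)
    have h2 : c * L ^ (-A + η) * L ^ (A - η / 2) ≤ C * L ^ (-A + η / 2) * L ^ (A - η / 2) :=
      mul_le_mul_of_nonneg_right h1 (Real.rpow_pos_of_pos hL0 _).le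
    rw [mul_assoc, ← Real.rpow_add hL0, mul_assoc, ← Real.rpow_add hL0] at h2
    rw [show -A + η + (A - η / 2) = η / 2 by ring, show -A + η / 2 + (A - η / 2) = 0 by ring,
      Real.rpow_zero, mul_one] at h2
    exact h2
  -- but `L^{η/2} → ∞`
  have hev : ∀ᶠ L : ℝ in atTop, C / c < L ^ (η / 2) ∧ (1 : ℝ) ≤ L :=
    ((tendsto_rpow_atTop (half_pos hη)).eventually_gt_atTop (C / c)).and (eventually_ge_atTop _)
  obtain ⟨L₀, hL₀⟩ := hev.exists_forall_of_atTop
  obtain ⟨L, hL₀L, hlowL⟩ := hlow L₀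
  have h := hL₀ L hL₀L
  have := hkey L h.2 hlowL
  have h1 := h.1
  rw [div_lt_iff₀ hc] at h1
  linarith [mul_comm c (L ^ (η / 2))]

end Iteration

end EndpointSobolev

end Summit.NavierStokesRegularity.NavierStokesRegularity.Theorems.PowerGaugeEulerLiouville
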